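import Mathlib.Analysis.InnerProductSpace.Projection.Basic
import Literature.Analysis.OperatorTheory.HilbertSchmidtOrthogonalSum
import HarnessLib

/-!
# Partial sums of a trace over orthonormal families, and the Hilbert–Schmidt sum against a
# «projection + rank-one» decomposition (Reed–Simon I, Thm. VI.18 / VI.22; the trace bookkeeping in the
# last step of Connes–Consani 2021, proof of Thm. 4.7)

Topic `Literature/Analysis/OperatorTheory`; theorems only (no definition, no named fact, no instance);
continuation of `HilbertSchmidtOrthogonalSum.lean`.  Mathlib has no trace class and no Hilbert–Schmidt
class; as there, "`Tr(T* T)`" of a bounded `T : E → F` between Hilbert spaces is the `ℝ≥0∞`-valued sum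
`Σ_k ‖T e_k‖²` over a Hilbert basis, which does not depend on the basis
(`tsum_enorm_sq_apply_eq_of_hilbertBasis`).  This file adds the facts that let a WEAK typing of a trace
inequality — "every partial sum `Σ_{i ∈ s} ⟨ξ_i | A ξ_i⟩` over a finite orthonormal family `(ξ_i)` of a
closed subspace `V` is `≤ M`", for a positive operator `A = T* T` — be proved with Hilbert–Schmidt sums:

* `sum_enorm_sq_apply_le_tsum`, `sum_enorm_sq_apply_le_tsum_of_mem` (real form
  `sum_norm_sq_apply_le_of_hasSum`) — **orthonormal partial sums are bounded by the trace**: for a finite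
  orthonormal family `(v_i)_{i ∈ s}` in `V` and ANY Hilbert basis `(b_k)` of `V`,
  `Σ_{i ∈ s} ‖T v_i‖² ≤ Σ_k ‖T b_k‖²` (Parseval in `F`, `⟨f_l, T v_i⟩ = ⟨T† f_l, v_i⟩`, Bessel's inequality
  for `(v_i)`, and `Σ_l ‖T† f_l‖² = Σ_k ‖T b_k‖²`; Reed–Simon I, Thm. VI.18: for `A ≥ 0` the sum
  `Σ ⟨φ_n, A φ_n⟩` over an orthonormal basis is independent of the basis — here in the form that it
  dominates every orthonormal partial sum);
* `tsum_ofReal_re_inner_eq_add_of_decomposition` (real form `hasSum_norm_sq_adjoint_of_decomposition`)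
  — **the trace against a decomposed positive operator**: if a bounded `Q` on `E` satisfies
  `Re⟨x | Q x⟩ = Σ_n μ_n |⟨χ_n | x⟩|² + ‖P_V x‖²` for all `x` (`μ_n ≥ 0`, arbitrary vectors `χ_n ∈ E`, `P_V`
  the orthogonal projection on `V`; i.e. `Q = Σ_n μ_n |χ_n⟩⟨χ_n| + P_V` as quadratic forms), then for
  every bounded `B : F → E` and every Hilbert basis `(e_k)` of `F`,
  `Σ_k Re⟨B e_k | Q B e_k⟩ = Σ_n μ_n ‖B† χ_n‖² + Σ_j ‖B† b_j‖²` with `(b_j)` any Hilbert basis of `V` — i.e.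
  "`Tr(B* Q B) = Σ_n μ_n ⟨χ_n | B B* | χ_n⟩ + Tr(P_V B B* P_V)`" (Tonelli for `ℝ≥0∞`-sums and Parseval
  twice); `hasSum_re_inner_of_hasSum_rankOne`, `re_inner_starProjection_eq_norm_sq` turn the strong form
  `Q x = Σ_n μ_n ⟨χ_n | x⟩ χ_n + P_V x` into this hypothesis;
* `hasSum_norm_sq_apply_of_hasSum[_of_mem]` — basis independence of the Hilbert–Schmidt sum in real
  (`HasSum`) form; `hasSum_norm_sq_apply_of_isLUB` — the "supremum over ALL finite orthonormal families
  of `V`" typing of a trace equals the Hilbert–Schmidt sum along any Hilbert basis of `V`;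
  `tsum_enorm_sq_starProjection_apply_eq` / `hasSum_norm_sq_starProjection_apply_iff` —
  `Σ_k ‖P_V R e_k‖² = Σ_j ‖R† b_j‖²`; `re_inner_starProjection_sandwich` —
  `Re⟨x | P_U P_W P_U x⟩ = ‖P_W P_U x‖²;
* `tsum_ofReal_re_inner_eq_tsum_enorm_sq` — if `Re⟨x | Q x⟩ = ‖C x‖²` (`Q = C* C`) the left side is the
  Hilbert–Schmidt sum of `C ∘ B`; and the three items assembled in the shape consumed downstream:
  `sum_norm_sq_adjoint_le_of_decomposition` — `Σ_{i ∈ s} ‖B† v_i‖² ≤ L − A` for finite orthonormal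
  `(v_i)` in `V`, when `Σ_k ‖C B e_k‖² = L` and `Σ_n μ_n ‖B† χ_n‖² = A`.

Why this is here (cell `rh-crit`, sub-cell `cc`, overflow row O4a: RH-FREE helper lemmas for the
discharge of A. Connes, C. Consani, *Weil positivity and trace formula, the archimedean place*, Selecta
Math. (N.S.) 27 (2021) 77 = arXiv:2006.13771 [bib: `ConnesConsani2021`], Thm. 4.7, in the weak-trace
typing of `Literature.NumberTheory.ConnesConsani2021.ArchimedeanSoninTrace` ("How the trace is typed")
and of the hypothesis `hTr` of
`Literature.NumberTheory.ConnesConsani2021.weilArchPositivity_soninTrace_fine_of_spectralData`).  The last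
step of the printed proof of Thm. 4.7 (§4, p. 18; arXiv chunk p0018) reads: "This gives the required
formula (sonine0) provided we prove that `Tr(ϑ(f) P P̂ P) = Tr(ϑ(f) 𝐒) + Σ λ(n)² ⟨χ_n | ϑ(f) χ_n⟩`.  This
follows from the spectral decomposition (spectral) of the operator `P P̂ P` since Sonin's space `S(1,1)`
is the eigenspace of `P P̂ P` for the eigenvalue `1`, so that `R = 𝐒`" (eq. (spectral) of Prop. 4.5 (iii),
p0016: `P P̂ P = Σ λ(n)² |χ_n⟩⟨χ_n| + R`), while the typed statement compares PARTIAL sums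
`Σ_i ⟨ξ_i | ϑ(g ∗ g*) ξ_i⟩ = Σ_i ‖ϑ(g)* ξ_i‖²` over finite orthonormal families of Sonin's space with
`Tr(ϑ(g) 𝐒 ϑ(g)*)`.  With `B = ϑ(g)`, `Q = P P̂ P`, `C = P̂ P`, `V = S(1,1)`, `μ_n = λ(n)²` the second and
third items ARE that step and the first item is the comparison, for the positive operator
`ϑ(g ∗ g*) = ϑ(g) ϑ(g)*`, with no trace class (every quantity is a Hilbert–Schmidt sum; the two sides
`Σ_k ‖P̂ P ϑ(g) e_k‖²` and `Σ_n λ(n)² ⟨χ_n | ϑ(f) χ_n⟩` are the objects the §2 / §4 statements compute).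
Nothing in this file mentions `L²(ℝ)`, zeta or RH: it is Hilbert-space bookkeeping.  Net debt delta 0.

## References

* M. Reed, B. Simon, *Methods of Modern Mathematical Physics I: Functional Analysis* (1972, rev. ed.
  1980), §VI.6, Thm. VI.18 (PDF p. 196 of the held copy), Thm. VI.22 (PDF p. 198). [ReedSimon1972]
* A. Connes, C. Consani, Selecta Math. (N.S.) 27 (2021) 77 = arXiv:2006.13771, §4, Prop. 4.5 (iii)
  eq. (spectral) (chunk p0016:L50) and the proof of Thm. 4.7, last step (chunk p0018). [ConnesConsani2021]
-/

noncomputable section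

open Filter Topology
open scoped InnerProductSpace ENNReal NNReal ComplexConjugate

namespace Literature.Analysis.OperatorTheory

variable {𝕜 : Type*} [RCLike 𝕜] {E F : Type*}
  [NormedAddCommGroup E] [InnerProductSpace 𝕜 E] [CompleteSpace E]
  [NormedAddCommGroup F] [InnerProductSpace 𝕜 F] [CompleteSpace F]

/-! ### Norm squares in `ℝ≥0∞` (plumbing) -/

/-- `‖x‖ₑ² = ofReal (‖x‖²)` (plumbing). [folklore] -/
private theorem enorm_sq_eq_ofReal_norm_sq {X : Type*} [SeminormedAddCommGroup X] (x : X) :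
    ‖x‖ₑ ^ 2 = ENNReal.ofReal (‖x‖ ^ 2) := by
  rw [← ofReal_norm, ENNReal.ofReal_pow (norm_nonneg _)]

/-- `(‖x‖ₑ²).toReal = ‖x‖²` (plumbing). [folklore] -/
private theorem toReal_enorm_sq {X : Type*} [SeminormedAddCommGroup X] (x : X) :
    (‖x‖ₑ ^ 2).toReal = ‖x‖ ^ 2 := by
  rw [enorm_sq_eq_ofReal_norm_sq, ENNReal.toReal_ofReal (sq_nonneg _)]

omit [CompleteSpace E] in
/-- `‖⟨x, y⟩‖ₑ = ‖⟨y, x⟩‖ₑ` (plumbing). [folklore] -/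
private theorem enorm_inner_symm (x y : E) : ‖⟪x, y⟫_𝕜‖ₑ = ‖⟪y, x⟫_𝕜‖ₑ := by
  rw [← ofReal_norm, ← ofReal_norm, norm_inner_symm]

/-! ### `‖T x‖²` through the adjoint; Bessel's inequality in `ℝ≥0∞` -/

/-- `Σ_l |⟨T† f_l, x⟩|² = ‖T x‖²` for a Hilbert basis `(f_l)` of `F` (Parseval for `T x`, moved to `E` by
the adjoint). [cite: ReedSimon1972, Thm. VI.18 (proof)] -/
theorem hasSum_norm_sq_inner_adjoint_apply {ι' : Type*} (c : HilbertBasis ι' 𝕜 F) (T : E →L[𝕜] F)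
    (x : E) :
    HasSum (fun l => ‖⟪ContinuousLinearMap.adjoint T (c l), x⟫_𝕜‖ ^ 2) (‖T x‖ ^ 2) := by
  convert hasSum_norm_inner_sq c (T x) using 2 with l
  rw [ContinuousLinearMap.adjoint_inner_left]

/-- The same in `ℝ≥0∞`: `Σ_l ‖⟨T† f_l, x⟩‖ₑ² = ‖T x‖ₑ²`. [cite: ReedSimon1972, Thm. VI.18 (proof)] -/
theorem tsum_enorm_sq_inner_adjoint_apply {ι' : Type*} (c : HilbertBasis ι' 𝕜 F) (T : E →L[𝕜] F)
    (x : E) :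
    ∑' l, ‖⟪ContinuousLinearMap.adjoint T (c l), x⟫_𝕜‖ₑ ^ 2 = ‖T x‖ₑ ^ 2 := by
  rw [← tsum_enorm_inner_sq c (T x)]
  refine tsum_congr fun l => ?_
  rw [ContinuousLinearMap.adjoint_inner_left]

omit [CompleteSpace E] in
/-- **Bessel's inequality** in `ℝ≥0∞`: `Σ_{i ∈ s} ‖⟨x, v_i⟩‖ₑ² ≤ ‖x‖ₑ²` for an orthonormal family `(v_i)`
(Reed–Simon I, §II.1, Corollary to Thm. II.1; Mathlib `Orthonormal.sum_inner_products_le`).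
[cite: ReedSimon1972, §II.1 Cor. to Thm. II.1 (Bessel's inequality), PDF p. 40] -/
theorem sum_enorm_inner_sq_le {κ : Type*} {v : κ → E} (hv : Orthonormal 𝕜 v) (x : E) (s : Finset κ) :
    ∑ i ∈ s, ‖⟪x, v i⟫_𝕜‖ₑ ^ 2 ≤ ‖x‖ₑ ^ 2 := by
  have h : ∑ i ∈ s, ‖⟪v i, x⟫_𝕜‖ ^ 2 ≤ ‖x‖ ^ 2 := hv.sum_inner_products_le x
  simp_rw [enorm_sq_eq_ofReal_norm_sq, norm_inner_symm x]
  rw [← ENNReal.ofReal_sum_of_nonneg (fun i _ => sq_nonneg _)]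
  exact ENNReal.ofReal_le_ofReal h

/-! ### Orthonormal partial sums are bounded by the Hilbert–Schmidt sum -/

/-- **Partial sums over an orthonormal family are bounded by the trace.**  For a bounded `T : E → F`, a
finite orthonormal family `(v_i)_{i ∈ s}` of `E` and ANY Hilbert basis `(b_k)` of `E`:
`Σ_{i ∈ s} ‖T v_i‖² ≤ Σ_k ‖T b_k‖²` (in `ℝ≥0∞`).  Proof: `‖T v_i‖² = Σ_l |⟨T† f_l, v_i⟩|²` for a Hilbert
basis `(f_l)` of `F`; interchange the sums; Bessel gives `Σ_{i ∈ s} |⟨T† f_l, v_i⟩|² ≤ ‖T† f_l‖²`; and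
`Σ_l ‖T† f_l‖² = Σ_k ‖T b_k‖²` (`tsum_enorm_sq_adjoint_apply_eq`).  This is Reed–Simon I, Thm. VI.18
("`tr A = Σ ⟨φ_n, Aφ_n⟩` is independent of the orthonormal basis", `A = T* T ≥ 0`) in the form that the
trace dominates the partial sums over every orthonormal family. [cite: ReedSimon1972, Thm. VI.18] -/
theorem sum_enorm_sq_apply_le_tsum {ι κ : Type*} (b : HilbertBasis ι 𝕜 E) (T : E →L[𝕜] F)
    {v : κ → E} (hv : Orthonormal 𝕜 v) (s : Finset κ) :
    ∑ i ∈ s, ‖T (v i)‖ₑ ^ 2 ≤ ∑' k, ‖T (b k)‖ₑ ^ 2 := by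
  obtain ⟨w, c, -⟩ := exists_hilbertBasis 𝕜 F
  rw [tsum_enorm_sq_apply_eq_tsum_enorm_sq_adjoint_apply b c T]
  calc ∑ i ∈ s, ‖T (v i)‖ₑ ^ 2
      = ∑ i ∈ s, ∑' l, ‖⟪ContinuousLinearMap.adjoint T (c l), v i⟫_𝕜‖ₑ ^ 2 := by
        simp_rw [tsum_enorm_sq_inner_adjoint_apply]
    _ = ∑' l, ∑ i ∈ s, ‖⟪ContinuousLinearMap.adjoint T (c l), v i⟫_𝕜‖ₑ ^ 2 :=
        (Summable.tsum_finsetSum fun _ _ => ENNReal.summable).symm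
    _ ≤ ∑' l, ‖ContinuousLinearMap.adjoint T (c l)‖ₑ ^ 2 :=
        ENNReal.tsum_le_tsum fun l => sum_enorm_inner_sq_le hv _ s

omit [CompleteSpace E] in
/-- **Partial sums over an orthonormal family of a closed subspace `V` are bounded by the trace over
`V`.**  For a bounded `T : E → F`, a finite orthonormal family `(v_i)_{i ∈ s}` with every `v_i ∈ V`, and
ANY Hilbert basis `(b_k)` of `V`: `Σ_{i ∈ s} ‖T v_i‖² ≤ Σ_k ‖T b_k‖²` (in `ℝ≥0∞`; the right side is
`Tr(P_V T* T P_V)`).  (`sum_enorm_sq_apply_le_tsum` in the Hilbert space `V` for `T ∘ ι_V`.)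
[cite: ReedSimon1972, Thm. VI.18] -/
theorem sum_enorm_sq_apply_le_tsum_of_mem {ι κ : Type*} {V : Submodule 𝕜 E} [CompleteSpace V]
    (bV : HilbertBasis ι 𝕜 V) (T : E →L[𝕜] F) {v : κ → E} (hv : Orthonormal 𝕜 v)
    (hvV : ∀ i, v i ∈ V) (s : Finset κ) :
    ∑ i ∈ s, ‖T (v i)‖ₑ ^ 2 ≤ ∑' k, ‖T (bV k : E)‖ₑ ^ 2 := by
  classical
  let v' : κ → V := fun i => ⟨v i, hvV i⟩
  have hv' : Orthonormal 𝕜 v' := by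
    rw [orthonormal_iff_ite] at hv ⊢
    intro i j
    rw [Submodule.coe_inner]
    exact hv i j
  exact sum_enorm_sq_apply_le_tsum bV (T ∘L V.subtypeL) hv' s

omit [CompleteSpace E] in
/-- **Real form.**  If the Hilbert–Schmidt sum of `T` over some Hilbert basis `(b_k)` of the closed
subspace `V` converges to `M` (`Σ_k ‖T b_k‖² = M`), then every finite orthonormal family `(v_i)_{i ∈ s}`
in `V` has `Σ_{i ∈ s} ‖T v_i‖² ≤ M`. [cite: ReedSimon1972, Thm. VI.18] -/
theorem sum_norm_sq_apply_le_of_hasSum {ι κ : Type*} {V : Submodule 𝕜 E} [CompleteSpace V]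
    (bV : HilbertBasis ι 𝕜 V) (T : E →L[𝕜] F) {M : ℝ}
    (hM : HasSum (fun k => ‖T (bV k : E)‖ ^ 2) M)
    {v : κ → E} (hv : Orthonormal 𝕜 v) (hvV : ∀ i, v i ∈ V) (s : Finset κ) :
    ∑ i ∈ s, ‖T (v i)‖ ^ 2 ≤ M := by
  have h := sum_enorm_sq_apply_le_tsum_of_mem bV T hv hvV s
  have hM0 : 0 ≤ M := hM.nonneg fun k => sq_nonneg _
  simp_rw [enorm_sq_eq_ofReal_norm_sq] at h
  rw [← ENNReal.ofReal_tsum_of_nonneg (fun k => sq_nonneg _) hM.summable, hM.tsum_eq,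
    ← ENNReal.ofReal_sum_of_nonneg (fun i _ => sq_nonneg _)] at h
  exact (ENNReal.ofReal_le_ofReal_iff hM0).1 h

/-! ### Basis independence in real (`HasSum`) form -/

/-- **Basis independence of the Hilbert–Schmidt sum, real form**: if `Σ_k ‖T b_k‖² = M` converges for
ONE Hilbert basis `(b_k)` of `E`, then `Σ_k ‖T b'_k‖² = M` for EVERY Hilbert basis `(b'_k)` (Reed–Simon I,
Thm. VI.18 / VI.22 (b): "independent of the orthonormal basis chosen"; the `ℝ≥0∞` form is
`tsum_enorm_sq_apply_eq_of_hilbertBasis`). [cite: ReedSimon1972, Thm. VI.18, PDF p. 196; Thm. VI.22 (b), PDF p. 198] -/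
theorem hasSum_norm_sq_apply_of_hasSum {ι ι' : Type*} (b : HilbertBasis ι 𝕜 E)
    (b' : HilbertBasis ι' 𝕜 E) (T : E →L[𝕜] F) {M : ℝ}
    (hM : HasSum (fun k => ‖T (b k)‖ ^ 2) M) :
    HasSum (fun k => ‖T (b' k)‖ ^ 2) M := by
  have hM0 : 0 ≤ M := hM.nonneg fun _ => sq_nonneg _
  have h1 : ∑' k, ‖T (b k)‖ₑ ^ 2 = ENNReal.ofReal M := by
    simp_rw [enorm_sq_eq_ofReal_norm_sq]
    rw [← ENNReal.ofReal_tsum_of_nonneg (fun _ => sq_nonneg _) hM.summable, hM.tsum_eq]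
  have h2 : ∑' k, ‖T (b' k)‖ₑ ^ 2 = ENNReal.ofReal M := by
    rw [← tsum_enorm_sq_apply_eq_of_hilbertBasis b b' T, h1]
  have hne : ∀ k, ‖T (b' k)‖ₑ ^ 2 ≠ ∞ := fun k => ENNReal.pow_ne_top enorm_ne_top
  have htop : ∑' k, ‖T (b' k)‖ₑ ^ 2 ≠ ∞ := by
    rw [h2]
    exact ENNReal.ofReal_ne_top
  have hsum := ENNReal.hasSum_toReal htop
  rw [← ENNReal.tsum_toReal_eq hne, h2, ENNReal.toReal_ofReal hM0] at hsum
  simpa only [toReal_enorm_sq] using hsum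

omit [CompleteSpace E] in
/-- The same inside a closed subspace `V`: if `Σ_k ‖T b_k‖² = M` for one Hilbert basis `(b_k)` of `V`
then `Σ_k ‖T b'_k‖² = M` for every Hilbert basis `(b'_k)` of `V` ("`Tr(P_V T* T P_V)`" is well defined).
[cite: ReedSimon1972, Thm. VI.18, PDF p. 196; Thm. VI.22 (b), PDF p. 198] -/
theorem hasSum_norm_sq_apply_of_hasSum_of_mem {ι ι' : Type*} {V : Submodule 𝕜 E} [CompleteSpace V]
    (bV : HilbertBasis ι 𝕜 V) (bV' : HilbertBasis ι' 𝕜 V) (T : E →L[𝕜] F) {M : ℝ}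
    (hM : HasSum (fun k => ‖T (bV k : E)‖ ^ 2) M) :
    HasSum (fun k => ‖T (bV' k : E)‖ ^ 2) M :=
  hasSum_norm_sq_apply_of_hasSum bV bV' (T ∘L V.subtypeL) hM

/-! ### The supremum over all finite orthonormal families is the Hilbert–Schmidt sum -/

omit [CompleteSpace E] in
/-- A Hilbert basis of a subspace `V`, read in `E`, is an orthonormal family of `E`. [folklore] -/
private theorem orthonormal_coe_hilbertBasis {ι : Type*} {V : Submodule 𝕜 E} (bV : HilbertBasis ι 𝕜 V) :
    Orthonormal 𝕜 fun k => (bV k : E) := by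
  classical
  have h := bV.orthonormal
  rw [orthonormal_iff_ite] at h ⊢
  intro i j
  rw [← Submodule.coe_inner]
  exact h i j

omit [CompleteSpace E] in
/-- **The supremum typing of a trace equals the Hilbert–Schmidt sum.**  If `L` is the least upper bound
of the partial sums `Σ_i ‖T v_i‖²` over ALL finite orthonormal families `(v_i)` of the closed subspace
`V` (the "sup over finite orthonormal families" typing of `Tr(P_V T* T P_V)`), then along every Hilbert
basis `(b_k)` of `V` the series `Σ_k ‖T b_k‖²` converges to `L` (partial sums along the basis are such
families; conversely every family is dominated by the basis sum, `sum_norm_sq_apply_le_of_hasSum`;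
Reed–Simon I, Thm. VI.18). [cite: ReedSimon1972, Thm. VI.18, PDF p. 196] -/
theorem hasSum_norm_sq_apply_of_isLUB {ι : Type*} {V : Submodule 𝕜 E} [CompleteSpace V]
    (bV : HilbertBasis ι 𝕜 V) (T : E →L[𝕜] F) {L : ℝ}
    (hL : IsLUB {s : ℝ | ∃ (n : ℕ) (v : Fin n → E), Orthonormal 𝕜 v ∧ (∀ i, v i ∈ V) ∧
      s = ∑ i, ‖T (v i)‖ ^ 2} L) :
    HasSum (fun k => ‖T (bV k : E)‖ ^ 2) L := by
  classical
  have hnn : 0 ≤ fun k => ‖T (bV k : E)‖ ^ 2 := fun k => sq_nonneg _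
  -- partial sums along the basis belong to the set, hence are `≤ L`
  have hpart : ∀ u : Finset ι, ∑ k ∈ u, ‖T (bV k : E)‖ ^ 2 ≤ L := by
    intro u
    refine hL.1 ⟨Fintype.card u, fun i => (bV ((Fintype.equivFin u).symm i : ι) : E), ?_, ?_, ?_⟩
    · exact (orthonormal_coe_hilbertBasis bV).comp _
        (Subtype.val_injective.comp (Fintype.equivFin u).symm.injective)
    · exact fun i => Submodule.coe_mem _
    · rw [← Finset.sum_coe_sort u, ← (Fintype.equivFin u).symm.sum_comp]
  have hsum : Summable fun k => ‖T (bV k : E)‖ ^ 2 := summable_of_sum_le hnn hpart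
  have hle : ∑' k, ‖T (bV k : E)‖ ^ 2 ≤ L := Real.tsum_le_of_sum_le hnn hpart
  -- every family is dominated by the basis sum
  have hge : L ≤ ∑' k, ‖T (bV k : E)‖ ^ 2 := by
    refine hL.2 ?_
    rintro s ⟨n, v, hv, hvV, rfl⟩
    exact sum_norm_sq_apply_le_of_hasSum bV T hsum.hasSum hv hvV Finset.univ
  rw [show L = ∑' k, ‖T (bV k : E)‖ ^ 2 from le_antisymm hge hle]
  exact hsum.hasSum

/-! ### The Hilbert–Schmidt sum of `P_V R` through the adjoint on a basis of `V` -/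

/-- **`Σ_k ‖P_V R e_k‖² = Σ_j ‖R† b_j‖²`** for a bounded `R : F → E`, a Hilbert basis `(e_k)` of `F` and a
Hilbert basis `(b_j)` of the closed subspace `V` (in `ℝ≥0∞`): Parseval in `V` for `P_V R e_k`,
`⟨b_j, R e_k⟩ = ⟨R† b_j, e_k⟩`, Tonelli, Parseval in `F` — "`Tr(P_V R R* P_V)` computed on either side"
(Reed–Simon I, Thm. VI.18 (proof) / VI.22). [cite: ReedSimon1972, Thm. VI.18 (proof), PDF p. 196; Thm. VI.22, PDF p. 198] -/
theorem tsum_enorm_sq_starProjection_apply_eq {ι κ : Type*} {V : Submodule 𝕜 E} [CompleteSpace V]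
    (bV : HilbertBasis ι 𝕜 V) (e : HilbertBasis κ 𝕜 F) (R : F →L[𝕜] E) :
    ∑' k, ‖V.starProjection (R (e k))‖ₑ ^ 2 =
      ∑' j, ‖ContinuousLinearMap.adjoint R (bV j : E)‖ₑ ^ 2 := by
  have hP : ∀ x : E, ‖V.starProjection x‖ₑ ^ 2 = ∑' j, ‖⟪(bV j : E), x⟫_𝕜‖ₑ ^ 2 := by
    intro x
    have hn : ‖V.starProjection x‖ₑ = ‖V.orthogonalProjectionOnto x‖ₑ := by
      rw [← ofReal_norm, ← ofReal_norm, Submodule.starProjection_apply, Submodule.norm_coe]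
    rw [hn, ← tsum_enorm_inner_sq bV (V.orthogonalProjectionOnto x)]
    refine tsum_congr fun j => ?_
    rw [Submodule.inner_orthogonalProjectionOnto_eq_of_mem_left]
  calc ∑' k, ‖V.starProjection (R (e k))‖ₑ ^ 2
      = ∑' k, ∑' j, ‖⟪(bV j : E), R (e k)⟫_𝕜‖ₑ ^ 2 := tsum_congr fun k => hP _
    _ = ∑' j, ∑' k, ‖⟪(bV j : E), R (e k)⟫_𝕜‖ₑ ^ 2 := ENNReal.tsum_comm
    _ = ∑' j, ‖ContinuousLinearMap.adjoint R (bV j : E)‖ₑ ^ 2 := by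
        refine tsum_congr fun j => ?_
        rw [← tsum_enorm_inner_sq e (ContinuousLinearMap.adjoint R (bV j : E))]
        refine tsum_congr fun k => ?_
        rw [← ContinuousLinearMap.adjoint_inner_left, enorm_inner_symm]

/-- **Real form**: `Σ_k ‖P_V R e_k‖² = L` (along a Hilbert basis of `F`) iff `Σ_j ‖R† b_j‖² = L` (along a
Hilbert basis of `V`). [cite: ReedSimon1972, Thm. VI.18 (proof), PDF p. 196; Thm. VI.22, PDF p. 198] -/
theorem hasSum_norm_sq_starProjection_apply_iff {ι κ : Type*} {V : Submodule 𝕜 E} [CompleteSpace V]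
    (bV : HilbertBasis ι 𝕜 V) (e : HilbertBasis κ 𝕜 F) (R : F →L[𝕜] E) {L : ℝ} :
    HasSum (fun k => ‖V.starProjection (R (e k))‖ ^ 2) L ↔
      HasSum (fun j => ‖ContinuousLinearMap.adjoint R (bV j : E)‖ ^ 2) L := by
  have key := tsum_enorm_sq_starProjection_apply_eq bV e R
  -- both real series have non-negative terms; pass through `ℝ≥0∞`
  constructor
  · intro h
    have hL0 : 0 ≤ L := h.nonneg fun _ => sq_nonneg _
    have h1 : ∑' k, ‖V.starProjection (R (e k))‖ₑ ^ 2 = ENNReal.ofReal L := by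
      simp_rw [enorm_sq_eq_ofReal_norm_sq]
      rw [← ENNReal.ofReal_tsum_of_nonneg (fun _ => sq_nonneg _) h.summable, h.tsum_eq]
    rw [h1] at key
    have hne : ∀ j, ‖ContinuousLinearMap.adjoint R (bV j : E)‖ₑ ^ 2 ≠ ∞ :=
      fun j => ENNReal.pow_ne_top enorm_ne_top
    have htop : ∑' j, ‖ContinuousLinearMap.adjoint R (bV j : E)‖ₑ ^ 2 ≠ ∞ := by
      rw [← key]; exact ENNReal.ofReal_ne_top
    have hs := ENNReal.hasSum_toReal htop
    rw [← ENNReal.tsum_toReal_eq hne, ← key, ENNReal.toReal_ofReal hL0] at hs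
    simpa only [toReal_enorm_sq] using hs
  · intro h
    have hL0 : 0 ≤ L := h.nonneg fun _ => sq_nonneg _
    have h1 : ∑' j, ‖ContinuousLinearMap.adjoint R (bV j : E)‖ₑ ^ 2 = ENNReal.ofReal L := by
      simp_rw [enorm_sq_eq_ofReal_norm_sq]
      rw [← ENNReal.ofReal_tsum_of_nonneg (fun _ => sq_nonneg _) h.summable, h.tsum_eq]
    rw [h1] at key
    have hne : ∀ k, ‖V.starProjection (R (e k))‖ₑ ^ 2 ≠ ∞ :=
      fun k => ENNReal.pow_ne_top enorm_ne_top
    have htop : ∑' k, ‖V.starProjection (R (e k))‖ₑ ^ 2 ≠ ∞ := by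
      rw [key]; exact ENNReal.ofReal_ne_top
    have hs := ENNReal.hasSum_toReal htop
    rw [← ENNReal.tsum_toReal_eq hne, key, ENNReal.toReal_ofReal hL0] at hs
    simpa only [toReal_enorm_sq] using hs

/-! ### From the strong form `Q x = Σ_n μ_n ⟨χ_n | x⟩ χ_n + P_V x` to the quadratic form -/

omit [CompleteSpace E] in
/-- **Reading a «sum of rank-one projections» as a quadratic form** (the form in which Connes–Consani's
eq. (spectral), `P P̂ P = Σ λ(n)² |χ_n⟩⟨χ_n| + R`, Dirac notation eq. (dirac) `|ξ⟩⟨η|(ξ′) = ξ ⟨η | ξ′⟩`, is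
consumed below): if `y = Σ_n μ_n ⟨χ_n | x⟩ χ_n` (norm-convergent in `E`, real `μ_n`), then
`Re⟨x | y⟩ = Σ_n μ_n |⟨χ_n | x⟩|²`.
[cite: ConnesConsani2021, Prop. 4.5 (iii) eq. (spectral) and the Dirac-notation display before Prop. 4.5, §4 pp. 16–17 (arXiv chunk p0016)] -/
theorem hasSum_re_inner_of_hasSum_rankOne {ι' : Type*} {χ : ι' → E} {μ : ι' → ℝ} {x y : E}
    (h : HasSum (fun n => ((μ n : ℝ) : 𝕜) • ⟪χ n, x⟫_𝕜 • χ n) y) :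
    HasSum (fun n => μ n * ‖⟪χ n, x⟫_𝕜‖ ^ 2) (RCLike.re ⟪x, y⟫_𝕜) := by
  have h1 : HasSum (fun n => ⟪x, ((μ n : ℝ) : 𝕜) • ⟪χ n, x⟫_𝕜 • χ n⟫_𝕜) ⟪x, y⟫_𝕜 :=
    (innerSL 𝕜 x).hasSum h
  have h2 := RCLike.reCLM.hasSum h1
  have h3 : (fun n => μ n * ‖⟪χ n, x⟫_𝕜‖ ^ 2) =
      fun n => RCLike.reCLM ⟪x, ((μ n : ℝ) : 𝕜) • ⟪χ n, x⟫_𝕜 • χ n⟫_𝕜 := by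
    funext n
    rw [RCLike.reCLM_apply, inner_smul_right, inner_smul_right, ← inner_conj_symm x (χ n),
      RCLike.mul_conj, ← RCLike.ofReal_pow, ← RCLike.ofReal_mul, RCLike.ofReal_re]
  rw [h3]
  exact h2

omit [CompleteSpace E] in
/-- `Re⟨x | P_V x⟩ = ‖P_V x‖²` for the orthogonal projection `P_V` onto a closed subspace (immediate from the
projection theorem `E = V ⊕ V^⊥`, Reed–Simon I, Thm. II.3: `P_V` is a self-adjoint idempotent).
[cite: ReedSimon1972, Thm. II.3 (projection theorem), PDF p. 43] -/
theorem re_inner_starProjection_eq_norm_sq {V : Submodule 𝕜 E} [V.HasOrthogonalProjection] (x : E) :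
    RCLike.re ⟪x, V.starProjection x⟫_𝕜 = ‖V.starProjection x‖ ^ 2 := by
  have hPP : V.starProjection (V.starProjection x) = V.starProjection x :=
    Submodule.starProjection_eq_self_iff.mpr (Submodule.starProjection_apply_mem V x)
  rw [← inner_self_eq_norm_sq (𝕜 := 𝕜), Submodule.inner_starProjection_left_eq_right, hPP]

omit [CompleteSpace E] in
/-- **The sandwich of two orthogonal projections is a square**: `Re⟨x | P_U P_W P_U x⟩ = ‖P_W P_U x‖²`
(self-adjointness and idempotence of `P_U`, `P_W`).  In the source: "the positive operator `P P̂ P`" of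
Prop. 2.2 (iii) / Prop. 4.5 (iii), with `⟨x | P P̂ P x⟩ = ‖P̂ P x‖²` — the hypothesis `hC` of
`sum_norm_sq_adjoint_le_of_decomposition` with `C = P_W ∘ P_U`.
[cite: ConnesConsani2021, Prop. 2.2 (iii) p. 10 (proof: "the positive operator `P P̂ P`")] [cite: ReedSimon1972, Thm. II.3 (projection theorem), PDF p. 43] -/
theorem re_inner_starProjection_sandwich {U W : Submodule 𝕜 E} [U.HasOrthogonalProjection]
    [W.HasOrthogonalProjection] (x : E) :
    RCLike.re ⟪x, U.starProjection (W.starProjection (U.starProjection x))⟫_𝕜 =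
      ‖W.starProjection (U.starProjection x)‖ ^ 2 := by
  rw [← Submodule.inner_starProjection_left_eq_right, re_inner_starProjection_eq_norm_sq]

omit [CompleteSpace E] in
/-- **Eq. (spectral) as a quadratic-form identity** — the hypothesis of
`tsum_ofReal_re_inner_eq_add_of_decomposition` from the strong (operator) form: if
`Q x − P_V x = Σ_n μ_n ⟨χ_n | x⟩ χ_n` for every `x` ("`P P̂ P = Σ λ(n)² |χ_n⟩⟨χ_n| + R`", `R = 𝐒` the
orthogonal projection on Sonin's space), then `Σ_n μ_n |⟨χ_n | x⟩|² = Re⟨x | Q x⟩ − ‖P_V x‖²`.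
[cite: ConnesConsani2021, Prop. 4.5 (iii) eq. (spectral), §4 pp. 16–17 (arXiv chunk p0016)] -/
theorem hasSum_re_inner_sub_of_hasSum_rankOne {ι' : Type*} {V : Submodule 𝕜 E}
    [V.HasOrthogonalProjection] {χ : ι' → E} {μ : ι' → ℝ} {Q : E →L[𝕜] E} {x : E}
    (h : HasSum (fun n => ((μ n : ℝ) : 𝕜) • ⟪χ n, x⟫_𝕜 • χ n) (Q x - V.starProjection x)) :
    HasSum (fun n => μ n * ‖⟪χ n, x⟫_𝕜‖ ^ 2)
      (RCLike.re ⟪x, Q x⟫_𝕜 - ‖V.starProjection x‖ ^ 2) := by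
  have h1 := hasSum_re_inner_of_hasSum_rankOne h
  rwa [inner_sub_right, map_sub, re_inner_starProjection_eq_norm_sq] at h1

/-! ### The trace against a «rank-one + projection» decomposition -/

/-- **`Tr(B* Q B) = Σ_n μ_n ‖B† χ_n‖² + Tr(P_V B B* P_V)`.**  Let `Q` be a bounded operator on `E` whose
quadratic form decomposes as `Re⟨x | Q x⟩ = Σ_n μ_n |⟨χ_n | x⟩|² + ‖P_V x‖²` for all `x` (`μ_n ≥ 0`, `χ_n ∈ E`
arbitrary vectors, `P_V` the orthogonal projection onto the closed subspace `V`: "`Q = Σ_n μ_n |χ_n⟩⟨χ_n| + R`,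
`R` the orthogonal projection on `V`" — Connes–Consani 2021, Prop. 4.5 (iii) eq. (spectral) with
`Q = P P̂ P`, `μ_n = λ(n)²`, `V = S(1,1)`).  Then for every bounded `B : F → E`, every Hilbert basis `(e_k)`
of `F` and every Hilbert basis `(b_j)` of `V`:
`Σ_k Re⟨B e_k | Q B e_k⟩ = Σ_n μ_n ‖B† χ_n‖² + Σ_j ‖B† b_j‖²` in `ℝ≥0∞` — the identity
"`Tr(ϑ(f) P P̂ P) = Tr(ϑ(f) 𝐒) + Σ λ(n)² ⟨χ_n | ϑ(f) χ_n⟩`" of the proof of Thm. 4.7 for `ϑ(f) = B B*`, with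
`⟨χ_n | B B* | χ_n⟩ = ‖B† χ_n‖²` and `Tr(ϑ(f) 𝐒) = Tr(𝐒 B B* 𝐒) = Σ_j ‖B† b_j‖²`.  Proof: expand each term,
interchange the `ℝ≥0∞`-sums (Tonelli), and resum with Parseval: `Σ_k |⟨χ_n | B e_k⟩|² = ‖B† χ_n‖²`,
`Σ_k ‖P_V B e_k‖² = Σ_k Σ_j |⟨b_j | B e_k⟩|² = Σ_j ‖B† b_j‖²`.
[cite: ConnesConsani2021, Thm. 4.7 §4 p. 18 (proof, last step); Prop. 4.5 (iii) eq. (spectral)]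
[cite: ReedSimon1972, Thm. VI.22] -/
theorem tsum_ofReal_re_inner_eq_add_of_decomposition {ι ι' κ : Type*} {V : Submodule 𝕜 E}
    [CompleteSpace V] (bV : HilbertBasis ι 𝕜 V) {χ : ι' → E} {μ : ι' → ℝ} (hμ : ∀ n, 0 ≤ μ n)
    {Q : E →L[𝕜] E}
    (hQ : ∀ x : E, HasSum (fun n => μ n * ‖⟪χ n, x⟫_𝕜‖ ^ 2)
      (RCLike.re ⟪x, Q x⟫_𝕜 - ‖V.starProjection x‖ ^ 2))
    (B : F →L[𝕜] E) (e : HilbertBasis κ 𝕜 F) :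
    ∑' k, ENNReal.ofReal (RCLike.re ⟪B (e k), Q (B (e k))⟫_𝕜) =
      (∑' n, ENNReal.ofReal (μ n) * ‖ContinuousLinearMap.adjoint B (χ n)‖ₑ ^ 2) +
        ∑' j, ‖ContinuousLinearMap.adjoint B (bV j : E)‖ₑ ^ 2 := by
  -- pointwise: `ofReal Re⟨x, Q x⟩ = Σ_n ofReal(μ_n) ‖⟨χ_n, x⟩‖ₑ² + ‖P_V x‖ₑ²`
  have hpt : ∀ x : E, ENNReal.ofReal (RCLike.re ⟪x, Q x⟫_𝕜) =
      (∑' n, ENNReal.ofReal (μ n) * ‖⟪χ n, x⟫_𝕜‖ₑ ^ 2) + ‖V.starProjection x‖ₑ ^ 2 := by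
    intro x
    have h := hQ x
    have hnn : ∀ n, 0 ≤ μ n * ‖⟪χ n, x⟫_𝕜‖ ^ 2 := fun n => mul_nonneg (hμ n) (sq_nonneg _)
    have hre : RCLike.re ⟪x, Q x⟫_𝕜 =
        (∑' n, μ n * ‖⟪χ n, x⟫_𝕜‖ ^ 2) + ‖V.starProjection x‖ ^ 2 := by
      rw [h.tsum_eq]; ring
    rw [hre, ENNReal.ofReal_add (tsum_nonneg hnn) (sq_nonneg _),
      ENNReal.ofReal_tsum_of_nonneg hnn h.summable, ← enorm_sq_eq_ofReal_norm_sq]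
    congr 1
    refine tsum_congr fun n => ?_
    rw [ENNReal.ofReal_mul (hμ n), enorm_sq_eq_ofReal_norm_sq]
  -- first piece: `Σ_k ‖⟨χ_n, B e_k⟩‖ₑ² = ‖B† χ_n‖ₑ²`
  have h1 : ∀ n, ∑' k, ‖⟪χ n, B (e k)⟫_𝕜‖ₑ ^ 2 = ‖ContinuousLinearMap.adjoint B (χ n)‖ₑ ^ 2 := by
    intro n
    rw [← tsum_enorm_inner_sq e (ContinuousLinearMap.adjoint B (χ n))]
    refine tsum_congr fun k => ?_
    rw [← ContinuousLinearMap.adjoint_inner_left, enorm_inner_symm]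
  -- second piece: `Σ_k ‖P_V B e_k‖ₑ² = Σ_j ‖B† b_j‖ₑ²`
  have hP : ∀ x : E, ‖V.starProjection x‖ₑ ^ 2 = ∑' j, ‖⟪(bV j : E), x⟫_𝕜‖ₑ ^ 2 := by
    intro x
    have hn : ‖V.starProjection x‖ₑ = ‖V.orthogonalProjectionOnto x‖ₑ := by
      rw [← ofReal_norm, ← ofReal_norm, Submodule.starProjection_apply, Submodule.norm_coe]
    rw [hn, ← tsum_enorm_inner_sq bV (V.orthogonalProjectionOnto x)]
    refine tsum_congr fun j => ?_
    rw [Submodule.inner_orthogonalProjectionOnto_eq_of_mem_left]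
  have h2 : ∑' k, ‖V.starProjection (B (e k))‖ₑ ^ 2 =
      ∑' j, ‖ContinuousLinearMap.adjoint B (bV j : E)‖ₑ ^ 2 := by
    calc ∑' k, ‖V.starProjection (B (e k))‖ₑ ^ 2
        = ∑' k, ∑' j, ‖⟪(bV j : E), B (e k)⟫_𝕜‖ₑ ^ 2 := tsum_congr fun k => hP _
      _ = ∑' j, ∑' k, ‖⟪(bV j : E), B (e k)⟫_𝕜‖ₑ ^ 2 := ENNReal.tsum_comm
      _ = ∑' j, ‖ContinuousLinearMap.adjoint B (bV j : E)‖ₑ ^ 2 := by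
          refine tsum_congr fun j => ?_
          rw [← tsum_enorm_inner_sq e (ContinuousLinearMap.adjoint B (bV j : E))]
          refine tsum_congr fun k => ?_
          rw [← ContinuousLinearMap.adjoint_inner_left, enorm_inner_symm]
  calc ∑' k, ENNReal.ofReal (RCLike.re ⟪B (e k), Q (B (e k))⟫_𝕜)
      = ∑' k, ((∑' n, ENNReal.ofReal (μ n) * ‖⟪χ n, B (e k)⟫_𝕜‖ₑ ^ 2) +
          ‖V.starProjection (B (e k))‖ₑ ^ 2) := tsum_congr fun k => hpt _
    _ = (∑' k, ∑' n, ENNReal.ofReal (μ n) * ‖⟪χ n, B (e k)⟫_𝕜‖ₑ ^ 2) +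
          ∑' k, ‖V.starProjection (B (e k))‖ₑ ^ 2 := ENNReal.tsum_add
    _ = (∑' n, ∑' k, ENNReal.ofReal (μ n) * ‖⟪χ n, B (e k)⟫_𝕜‖ₑ ^ 2) +
          ∑' k, ‖V.starProjection (B (e k))‖ₑ ^ 2 := by rw [ENNReal.tsum_comm]
    _ = (∑' n, ENNReal.ofReal (μ n) * ∑' k, ‖⟪χ n, B (e k)⟫_𝕜‖ₑ ^ 2) +
          ∑' k, ‖V.starProjection (B (e k))‖ₑ ^ 2 := by simp_rw [ENNReal.tsum_mul_left]
    _ = (∑' n, ENNReal.ofReal (μ n) * ‖ContinuousLinearMap.adjoint B (χ n)‖ₑ ^ 2) +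
          ∑' j, ‖ContinuousLinearMap.adjoint B (bV j : E)‖ₑ ^ 2 := by simp_rw [h1, h2]

omit [CompleteSpace E] [CompleteSpace F] in
/-- **`Tr(B* Q B)` for `Q = C* C` is the Hilbert–Schmidt sum of `C ∘ B`**: if `Re⟨x | Q x⟩ = ‖C x‖²` for
all `x` (e.g. `Q = P P̂ P`, `C = P̂ P` for two orthogonal projections `P, P̂`: `⟨x | P P̂ P x⟩ = ‖P̂ P x‖²`),
then `Σ_k Re⟨B e_k | Q B e_k⟩ = Σ_k ‖C B e_k‖²` — the Hilbert–Schmidt norm `‖C B‖₂² = tr((CB)* CB)`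
(Reed–Simon I, Thm. VI.22 (d)); in the source this is `Tr(ϑ(f) P P̂ P)` for `ϑ(f) = B B*`.
[cite: ReedSimon1972, Thm. VI.22 (d), PDF p. 198] [cite: ConnesConsani2021, Thm. 4.7 §4 p. 18 (proof, last step)] -/
theorem tsum_ofReal_re_inner_eq_tsum_enorm_sq {κ : Type*} {G : Type*} [NormedAddCommGroup G]
    [InnerProductSpace 𝕜 G] {Q : E →L[𝕜] E} {C : E →L[𝕜] G}
    (hC : ∀ x, RCLike.re ⟪x, Q x⟫_𝕜 = ‖C x‖ ^ 2) (B : F →L[𝕜] E) (e : HilbertBasis κ 𝕜 F) :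
    ∑' k, ENNReal.ofReal (RCLike.re ⟪B (e k), Q (B (e k))⟫_𝕜) = ∑' k, ‖C (B (e k))‖ₑ ^ 2 :=
  tsum_congr fun k => by rw [hC, enorm_sq_eq_ofReal_norm_sq]

/-- **Real form of the decomposition.**  Under the hypotheses of
`tsum_ofReal_re_inner_eq_add_of_decomposition`, if `Σ_k Re⟨B e_k | Q B e_k⟩ = L` and
`Σ_n μ_n ‖B† χ_n‖² = A` converge as real series, then the Hilbert–Schmidt sum of `B†` over the Hilbert
basis `(b_j)` of `V` converges, to `L − A`: `Σ_j ‖B† b_j‖² = L − A` ("`Tr(ϑ(f) 𝐒) = Tr(ϑ(f) P P̂ P) −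
Σ λ(n)² ⟨χ_n | ϑ(f) χ_n⟩`").
[cite: ConnesConsani2021, Thm. 4.7 §4 p. 18 (proof, last step)] [cite: ReedSimon1972, Thm. VI.22] -/
theorem hasSum_norm_sq_adjoint_of_decomposition {ι ι' κ : Type*} {V : Submodule 𝕜 E}
    [CompleteSpace V] (bV : HilbertBasis ι 𝕜 V) {χ : ι' → E} {μ : ι' → ℝ} (hμ : ∀ n, 0 ≤ μ n)
    {Q : E →L[𝕜] E}
    (hQ : ∀ x : E, HasSum (fun n => μ n * ‖⟪χ n, x⟫_𝕜‖ ^ 2)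
      (RCLike.re ⟪x, Q x⟫_𝕜 - ‖V.starProjection x‖ ^ 2))
    (B : F →L[𝕜] E) (e : HilbertBasis κ 𝕜 F) {L A : ℝ}
    (hL : HasSum (fun k => RCLike.re ⟪B (e k), Q (B (e k))⟫_𝕜) L)
    (hA : HasSum (fun n => μ n * ‖ContinuousLinearMap.adjoint B (χ n)‖ ^ 2) A) :
    HasSum (fun j => ‖ContinuousLinearMap.adjoint B (bV j : E)‖ ^ 2) (L - A) := by
  have hdec := tsum_ofReal_re_inner_eq_add_of_decomposition bV hμ hQ B e
  -- every `Re⟨x, Q x⟩` is non-negative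
  have hQnn : ∀ x : E, 0 ≤ RCLike.re ⟪x, Q x⟫_𝕜 := by
    intro x
    have h := (hQ x).nonneg fun n => mul_nonneg (hμ n) (sq_nonneg _)
    linarith [sq_nonneg ‖V.starProjection x‖]
  have hL0 : 0 ≤ L := hL.nonneg fun k => hQnn _
  have hAnn : ∀ n, 0 ≤ μ n * ‖ContinuousLinearMap.adjoint B (χ n)‖ ^ 2 :=
    fun n => mul_nonneg (hμ n) (sq_nonneg _)
  have hA0 : 0 ≤ A := hA.nonneg hAnn
  -- the two convergent pieces as `ofReal`s
  have hLe : ∑' k, ENNReal.ofReal (RCLike.re ⟪B (e k), Q (B (e k))⟫_𝕜) = ENNReal.ofReal L := by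
    rw [← ENNReal.ofReal_tsum_of_nonneg (fun k => hQnn _) hL.summable, hL.tsum_eq]
  have hAe : ∑' n, ENNReal.ofReal (μ n) * ‖ContinuousLinearMap.adjoint B (χ n)‖ₑ ^ 2 =
      ENNReal.ofReal A := by
    rw [← hA.tsum_eq, ENNReal.ofReal_tsum_of_nonneg hAnn hA.summable]
    refine tsum_congr fun n => ?_
    rw [ENNReal.ofReal_mul (hμ n), enorm_sq_eq_ofReal_norm_sq]
  rw [hLe, hAe] at hdec
  -- the remaining piece is finite, with real value `L - A`
  set X := ∑' j, ‖ContinuousLinearMap.adjoint B (bV j : E)‖ₑ ^ 2 with hX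
  have hXtop : X ≠ ∞ := by
    intro h
    rw [h, add_top] at hdec
    exact ENNReal.ofReal_ne_top hdec
  have hXreal : X.toReal = L - A := by
    have h := congrArg ENNReal.toReal hdec
    rw [ENNReal.toReal_add ENNReal.ofReal_ne_top hXtop, ENNReal.toReal_ofReal hL0,
      ENNReal.toReal_ofReal hA0] at h
    linarith
  have hne : ∀ j, ‖ContinuousLinearMap.adjoint B (bV j : E)‖ₑ ^ 2 ≠ ∞ :=
    fun j => ENNReal.pow_ne_top enorm_ne_top
  have hsum := ENNReal.hasSum_toReal hXtop
  rw [← ENNReal.tsum_toReal_eq hne, ← hX, hXreal] at hsum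
  simpa only [toReal_enorm_sq] using hsum

/-- **The three facts assembled in the shape consumed downstream** (Connes–Consani 2021, proof of
Thm. 4.7 in the weak-trace typing, for `ϑ(f) = B B*`): if `Re⟨x | Q x⟩ = ‖C x‖²` (`Q = C* C`),
`Re⟨x | Q x⟩ = Σ_n μ_n |⟨χ_n | x⟩|² + ‖P_V x‖²` (`μ_n ≥ 0`), the Hilbert–Schmidt sum `Σ_k ‖C B e_k‖²`
converges to `L` and `Σ_n μ_n ‖B† χ_n‖²` converges to `A`, then EVERY finite orthonormal family
`(v_i)_{i ∈ s}` in `V` satisfies `Σ_{i ∈ s} ‖B† v_i‖² ≤ L − A` (in the source: `L = Tr(ϑ(f) P P̂ P)`,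
`A = Σ λ(n)² ⟨χ_n | ϑ(f) χ_n⟩`, the partial sums of `Tr(ϑ(f) 𝐒)` on the left).
[cite: ConnesConsani2021, Thm. 4.7 §4 p. 18 (proof, last step)] [cite: ReedSimon1972, Thm. VI.18] -/
theorem sum_norm_sq_adjoint_le_of_decomposition {ι' κ κ' : Type*} {G : Type*}
    [NormedAddCommGroup G] [InnerProductSpace 𝕜 G] {V : Submodule 𝕜 E} [CompleteSpace V]
    {χ : ι' → E} {μ : ι' → ℝ} (hμ : ∀ n, 0 ≤ μ n) {Q : E →L[𝕜] E} {C : E →L[𝕜] G}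
    (hC : ∀ x, RCLike.re ⟪x, Q x⟫_𝕜 = ‖C x‖ ^ 2)
    (hQ : ∀ x : E, HasSum (fun n => μ n * ‖⟪χ n, x⟫_𝕜‖ ^ 2)
      (RCLike.re ⟪x, Q x⟫_𝕜 - ‖V.starProjection x‖ ^ 2))
    (B : F →L[𝕜] E) (e : HilbertBasis κ 𝕜 F) {L A : ℝ}
    (hL : HasSum (fun k => ‖C (B (e k))‖ ^ 2) L)
    (hA : HasSum (fun n => μ n * ‖ContinuousLinearMap.adjoint B (χ n)‖ ^ 2) A)
    {v : κ' → E} (hv : Orthonormal 𝕜 v) (hvV : ∀ i, v i ∈ V) (s : Finset κ') :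
    ∑ i ∈ s, ‖ContinuousLinearMap.adjoint B (v i)‖ ^ 2 ≤ L - A := by
  obtain ⟨w, bV, -⟩ := exists_hilbertBasis 𝕜 V
  have hL' : HasSum (fun k => RCLike.re ⟪B (e k), Q (B (e k))⟫_𝕜) L := by
    convert hL using 2 with k
    exact hC _
  exact sum_norm_sq_apply_le_of_hasSum bV (ContinuousLinearMap.adjoint B)
    (hasSum_norm_sq_adjoint_of_decomposition bV hμ hQ B e hL' hA) hv hvV s

end Literature.Analysis.OperatorTheory

end
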